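import Mathlib.Analysis.Convex.Deriv
import Mathlib.Analysis.Convex.Mul
import Mathlib.Analysis.Convex.Jensen
import Mathlib.Analysis.SpecialFunctions.Pow.Deriv
import Literature.MathematicalPhysics.QuantumLattice.AnisotropicKLSMargin
import HarnessLib

/-!
# Kennedy–Lieb–Shastry's convexity reduction for direction-dependent couplings: the layered
# integrand is dominated pointwise by a convex combination of two-dimensional integrands

Topic `MathematicalPhysics/QuantumLattice`; companion of `AnisotropicKLSMargin.lean` (the integrand
`F_K = anisoKlsIntegrand K`) and `AnisotropicKLSIntegral.lean` (the hypothesis `I_K < n√2/2` of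
`xyAniso_longRangeOrder_{ground,thermal}_of_integral`). Kennedy–Lieb–Shastry prove `I(ν) ≤ I(2)`
for the isotropic XY integrand ([KLS1988PRL], p. 2584, after eq. (8): "`F(x) = x[(1+x)/(1-x)]^{1/2}`
… is monotone increasing and convex", `Y = (ν²-ν)⁻¹Σ_{i≠j}Y_{ij}`, `{a+b}₊ ≤ {a}₊ + {b}₊`, Jensen).
Here the same argument is carried out for the integrand of direction-dependent couplings, which is
a function of ONE scalar: since `E^K_p = κ_K - C_K(p)`,

`F_K(p) = H(C_K(p)/κ_K)`, `H(y) = y₊ √(2/(1-y))` (`anisoKlsIntegrand_eq_klsH`),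

with `H` nondecreasing and convex below `1` (`monotoneOn_klsH`, `convexOn_klsH`); for the layered
couplings `K = (1, 1, r)`, `0 ≤ r ≤ 2`, the weight vector `(1,1,r)/(2+r)` is the convex combination
`λ₁₂ = (2-r)/(2+r)`, `λ₁₃ = λ₂₃ = r/(2+r)` of the pair averages, whence the POINTWISE domination

`F_{(1,1,r)}(p) ≤ λ₁₂ H(½(cos p₀ + cos p₁)) + λ₁₃ H(½(cos p₀ + cos p₂)) + λ₂₃ H(½(cos p₁ + cos p₂))`

(`anisoKlsIntegrand_layered_le_pairs`) off the null set where two of the `cos pᵢ` equal `1` (there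
the right side takes the junk value `H(1) = 0`), and `H(½(cos a + cos b))` is the two-dimensional
integrand `anisoKlsIntegrand (1,1) (a,b)` (`anisoKlsIntegrand_two_eq_klsH`). Integrating (each pair
term integrates to the `d = 2` integral) gives `I_{(1,1,r)} ≤ I_{(1,1)}` for `0 ≤ r ≤ 2`; that
measure-theoretic step and the value of the two-dimensional integral are NOT done in this file.
All statements here are real inequalities; no named fact is introduced.

## References

* [KLS1988PRL] T. Kennedy, E. H. Lieb, B. S. Shastry, Phys. Rev. Lett. 61 (1988) 2582–2584,
  p. 2584 (the paragraph "To prove LRO for ν > 3 we must bound I(ν) …").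
-/

noncomputable section

open Set
open Literature.MathematicalPhysics.QuantumLattice Literature.Probability.LatticeModels

namespace Literature.MathematicalPhysics.QuantumLattice

/-! ### The one-variable function `H(y) = y₊ √(2/(1-y))` -/

section KLSH

/-- `d/dx (1 - x) = -1`. [folklore] -/
private theorem klsH_hasDerivAt_one_sub (x : ℝ) : HasDerivAt (fun x : ℝ => 1 - x) (-1) x := by
  simpa using (hasDerivAt_id' x).const_sub 1

/-- `ψ(x) = (1 - x)^{-1/2}` has derivative `½ (1 - x)^{-3/2}` for `x ≠ 1`. [folklore] -/
private theorem klsH_hasDerivAt_psi {x : ℝ} (hx : 1 - x ≠ 0) :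
    HasDerivAt (fun x : ℝ => (1 - x) ^ (-(1 / 2 : ℝ))) (1 / 2 * (1 - x) ^ (-(3 / 2 : ℝ))) x := by
  have h := (klsH_hasDerivAt_one_sub x).rpow_const (p := -(1 / 2 : ℝ)) (Or.inl hx)
  refine h.congr_deriv ?_
  rw [show (-(1 / 2 : ℝ)) - 1 = -(3 / 2 : ℝ) by norm_num]
  ring

/-- `x ↦ ½(1 - x)^{-3/2}` has derivative `¾ (1 - x)^{-5/2}` for `x ≠ 1`. [folklore] -/
private theorem klsH_hasDerivAt_psi_deriv {x : ℝ} (hx : 1 - x ≠ 0) :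
    HasDerivAt (fun x : ℝ => 1 / 2 * (1 - x) ^ (-(3 / 2 : ℝ))) (3 / 4 * (1 - x) ^ (-(5 / 2 : ℝ))) x := by
  have h := ((klsH_hasDerivAt_one_sub x).rpow_const (p := -(3 / 2 : ℝ)) (Or.inl hx)).const_mul (1 / 2 : ℝ)
  refine h.congr_deriv ?_
  rw [show (-(3 / 2 : ℝ)) - 1 = -(5 / 2 : ℝ) by norm_num]
  ring

/-- `ψ(x) = (1 - x)^{-1/2}` is convex on `[0, 1)` (second derivative `¾(1-x)^{-5/2} ≥ 0`).
[folklore] -/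
private theorem klsH_convexOn_psi :
    ConvexOn ℝ (Ico (0 : ℝ) 1) (fun x : ℝ => (1 - x) ^ (-(1 / 2 : ℝ))) := by
  have hint : interior (Ico (0 : ℝ) 1) = Ioo 0 1 := interior_Ico
  refine convexOn_of_hasDerivWithinAt2_nonneg (convex_Ico 0 1)
    (f' := fun x => 1 / 2 * (1 - x) ^ (-(3 / 2 : ℝ)))
    (f'' := fun x => 3 / 4 * (1 - x) ^ (-(5 / 2 : ℝ))) ?_ ?_ ?_ ?_
  · intro x hx
    exact (klsH_hasDerivAt_psi (by linarith [hx.2] : (1 : ℝ) - x ≠ 0)).continuousAt.continuousWithinAt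
  · intro x hx
    rw [hint] at hx ⊢
    exact (klsH_hasDerivAt_psi (by linarith [hx.2] : (1 : ℝ) - x ≠ 0)).hasDerivWithinAt
  · intro x hx
    rw [hint] at hx ⊢
    exact (klsH_hasDerivAt_psi_deriv (by linarith [hx.2] : (1 : ℝ) - x ≠ 0)).hasDerivWithinAt
  · intro x hx
    rw [hint] at hx
    have hb : 0 ≤ 1 - x := by linarith [hx.2]
    positivity

/-- `ψ(x) = (1 - x)^{-1/2}` is nondecreasing on `[0, 1)`. [folklore] -/
private theorem klsH_monotoneOn_psi :
    MonotoneOn (fun x : ℝ => (1 - x) ^ (-(1 / 2 : ℝ))) (Ico (0 : ℝ) 1) := by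
  intro x₁ h₁ x₂ h₂ h
  have hb₂ : 0 < 1 - x₂ := by linarith [h₂.2]
  have hle : 1 - x₂ ≤ 1 - x₁ := by linarith
  exact (Real.rpow_le_rpow_iff_of_neg (hb₂.trans_le hle) hb₂ (by norm_num)).2 hle

/-- `h(x) = (√2·x)(1 - x)^{-1/2}` (`= H` on `[0,1)`) is convex on `[0, 1)`: a product of two nonnegative
nondecreasing convex functions. [cite: KLS1988PRL, after eq. (8)] -/
theorem convexOn_klsH_core :
    ConvexOn ℝ (Ico (0 : ℝ) 1) (fun x : ℝ => (Real.sqrt 2 * x) * (1 - x) ^ (-(1 / 2 : ℝ))) := by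
  have hl : ConvexOn ℝ (Ico (0 : ℝ) 1) (fun x : ℝ => Real.sqrt 2 * x) :=
    ((convexOn_id (convex_Ico 0 1)).smul (Real.sqrt_nonneg 2)).congr fun x _ => by simp [smul_eq_mul]
  have hlm : MonotoneOn (fun x : ℝ => Real.sqrt 2 * x) (Ico (0 : ℝ) 1) :=
    fun x₁ _ x₂ _ h => mul_le_mul_of_nonneg_left h (Real.sqrt_nonneg 2)
  exact hl.mul klsH_convexOn_psi (fun x hx => by have := hx.1; positivity)
    (fun x hx => Real.rpow_nonneg (by linarith [hx.2]) _)
    (hlm.monovaryOn klsH_monotoneOn_psi)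

/-- `h` is nondecreasing on `[0, 1)`. [folklore] -/
private theorem monotoneOn_klsH_core :
    MonotoneOn (fun x : ℝ => (Real.sqrt 2 * x) * (1 - x) ^ (-(1 / 2 : ℝ))) (Ico (0 : ℝ) 1) := by
  intro x₁ h₁ x₂ h₂ h
  have := h₁.1
  exact mul_le_mul (mul_le_mul_of_nonneg_left h (Real.sqrt_nonneg 2))
    (klsH_monotoneOn_psi h₁ h₂ h) (Real.rpow_nonneg (by linarith [h₁.2]) _)
    (by have := h₂.1; positivity)

/-- `H = h ∘ (·)₊` below `1`: `y₊ √(2/(1-y)) = (√2·y₊)(1 - y₊)^{-1/2}` for `y < 1`. [folklore] -/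
private theorem klsH_eq_core_pos {y : ℝ} (hy : y < 1) :
    max y 0 * Real.sqrt (2 / (1 - y)) =
      (Real.sqrt 2 * max y 0) * (1 - max y 0) ^ (-(1 / 2 : ℝ)) := by
  rcases le_or_gt y 0 with h | h
  · simp [max_eq_right h]
  · rw [max_eq_left h.le]
    have h1 : (0 : ℝ) < 1 - y := by linarith
    rw [Real.sqrt_div' 2 h1.le, Real.rpow_neg h1.le, ← Real.sqrt_eq_rpow, div_eq_mul_inv]
    ring

/-- **`H(y) = y₊ √(2/(1-y))` is convex on `(-∞, 1)`** — the anisotropic counterpart of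
Kennedy–Lieb–Shastry's "`F` is … convex". [cite: KLS1988PRL, after eq. (8)] -/
theorem convexOn_klsH :
    ConvexOn ℝ (Iio (1 : ℝ)) (fun y : ℝ => max y 0 * Real.sqrt (2 / (1 - y))) := by
  have himg : (fun y : ℝ => max y 0) '' Iio (1 : ℝ) = Ico 0 1 := by
    ext z
    simp only [mem_image, mem_Iio, mem_Ico]
    constructor
    · rintro ⟨y, hy, rfl⟩
      exact ⟨le_max_right _ _, max_lt hy one_pos⟩
    · rintro ⟨hz1, hz2⟩
      exact ⟨z, hz2, max_eq_left hz1⟩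
  have hpos : ConvexOn ℝ (Iio (1 : ℝ)) (fun y : ℝ => max y 0) :=
    (convexOn_id (convex_Iio _)).sup (convexOn_const 0 (convex_Iio _))
  have hg : ConvexOn ℝ ((fun y : ℝ => max y 0) '' Iio (1 : ℝ))
      (fun x : ℝ => (Real.sqrt 2 * x) * (1 - x) ^ (-(1 / 2 : ℝ))) := by
    rw [himg]; exact convexOn_klsH_core
  have hg' : MonotoneOn (fun x : ℝ => (Real.sqrt 2 * x) * (1 - x) ^ (-(1 / 2 : ℝ)))
      ((fun y : ℝ => max y 0) '' Iio (1 : ℝ)) := by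
    rw [himg]; exact monotoneOn_klsH_core
  refine (hg.comp hpos hg').congr fun y hy => ?_
  simp only [Function.comp]
  exact (klsH_eq_core_pos hy).symm

/-- **`H` is nondecreasing on `(-∞, 1)`** ("`F` is monotone increasing").
[cite: KLS1988PRL, after eq. (8)] -/
theorem monotoneOn_klsH :
    MonotoneOn (fun y : ℝ => max y 0 * Real.sqrt (2 / (1 - y))) (Iio (1 : ℝ)) := by
  intro y₁ h₁ y₂ h₂ h
  have h₂' : y₂ < 1 := h₂
  have hq : 2 / (1 - y₁) ≤ 2 / (1 - y₂) :=
    div_le_div_of_nonneg_left (by norm_num) (by linarith) (by linarith)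
  exact mul_le_mul (max_le_max h le_rfl) (Real.sqrt_le_sqrt hq) (Real.sqrt_nonneg _)
    (le_max_right _ _)

end KLSH

/-! ### The integrand as a function of `C_K/κ_K`, and the pair domination for `K = (1, 1, r)` -/

section Pairs

variable {d : ℕ}

/-- `E^K_p = κ_K - C_K(p)`. [cite: KLS1988JSP, eq. (9)] -/
theorem anisoDispersion_eq_sum_sub_anisoCosSum (K : Fin d → ℝ) (p : Fin d → ℝ) :
    NVectorAniso.anisoDispersion K p = (∑ i, K i) - anisoCosSum K p := by
  simp only [NVectorAniso.anisoDispersion, anisoCosSum, mul_sub, mul_one, Finset.sum_sub_distrib]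

/-- **The anisotropic KLS integrand is a function of one scalar:**
`F_K(p) = H(y)`, `y = C_K(p)/κ_K`, `H(y) = y₊√(2/(1-y))`, whenever `κ_K > 0`.
[cite: KLS1988PRL, eq. (8)] -/
theorem anisoKlsIntegrand_eq_klsH {K : Fin d → ℝ} (hκ : 0 < ∑ i, K i) (p : Fin d → ℝ) :
    anisoKlsIntegrand K p =
      max (anisoCosSum K p / ∑ i, K i) 0 * Real.sqrt (2 / (1 - anisoCosSum K p / ∑ i, K i)) := by
  set κ : ℝ := ∑ i, K i with hκ_def
  set C : ℝ := anisoCosSum K p with hC_def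
  unfold anisoKlsIntegrand
  rw [anisoDispersion_eq_sum_sub_anisoCosSum, ← hκ_def, ← hC_def]
  have h1 : max C 0 = κ * max (C / κ) 0 := by
    rw [mul_max_of_nonneg _ _ hκ.le, mul_div_cancel₀ _ hκ.ne', mul_zero]
  have h2 : 2 / (κ * (κ - C)) = (2 / (1 - C / κ)) / κ ^ 2 := by
    have e : (1 - C / κ) * κ ^ 2 = κ * (κ - C) := by
      field_simp
    rw [div_div, e]
  rw [h1, h2, Real.sqrt_div' _ (sq_nonneg κ), Real.sqrt_sq hκ.le]
  field_simp

/-- The two-dimensional integrand: `F_{(1,1)}(a, b) = H(½(cos a + cos b))`.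
[cite: KLS1988PRL, eq. (8)] -/
theorem anisoKlsIntegrand_two_eq_klsH (a b : ℝ) :
    anisoKlsIntegrand ![(1 : ℝ), 1] ![a, b] =
      max ((Real.cos a + Real.cos b) / 2) 0 *
        Real.sqrt (2 / (1 - (Real.cos a + Real.cos b) / 2)) := by
  have hs : ∑ i, (![(1 : ℝ), 1]) i = 2 := by simp [Fin.sum_univ_two]; norm_num
  have hκ : (0 : ℝ) < ∑ i, (![(1 : ℝ), 1]) i := by rw [hs]; norm_num
  have hC : anisoCosSum ![(1 : ℝ), 1] ![a, b] = Real.cos a + Real.cos b := by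
    simp [anisoCosSum, Fin.sum_univ_two]
  rw [anisoKlsIntegrand_eq_klsH hκ, hs, hC]

/-- **Pair domination for the layered couplings** (Kennedy–Lieb–Shastry's convexity step, weighted):
for `0 ≤ r ≤ 2` and `p` with no two of `cos pᵢ` equal to `1`,
`F_{(1,1,r)}(p) ≤ λ₁₂ H(½(c₀+c₁)) + λ H(½(c₀+c₂)) + λ H(½(c₁+c₂))`, `cᵢ = cos pᵢ`,
`λ₁₂ = (2-r)/(2+r)`, `λ = r/(2+r)` — because `(c₀ + c₁ + r c₂)/(2+r) = λ₁₂·½(c₀+c₁) + λ·½(c₀+c₂) +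
λ·½(c₁+c₂)`, `{·}₊` is subadditive, and `H` is nondecreasing and convex below `1`. (On the excluded
null set the right side carries the junk value `H(1) = 0`.) [cite: KLS1988PRL, after eq. (8)] -/
theorem anisoKlsIntegrand_layered_le_pairs {r : ℝ} (hr0 : 0 ≤ r) (hr2 : r ≤ 2) (p : Fin 3 → ℝ)
    (hp : ∀ i j : Fin 3, i ≠ j → Real.cos (p i) + Real.cos (p j) < 2) :
    anisoKlsIntegrand ![(1 : ℝ), 1, r] p ≤
      (2 - r) / (2 + r) *
          (max ((Real.cos (p 0) + Real.cos (p 1)) / 2) 0 *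
            Real.sqrt (2 / (1 - (Real.cos (p 0) + Real.cos (p 1)) / 2))) +
        r / (2 + r) *
          (max ((Real.cos (p 0) + Real.cos (p 2)) / 2) 0 *
            Real.sqrt (2 / (1 - (Real.cos (p 0) + Real.cos (p 2)) / 2))) +
        r / (2 + r) *
          (max ((Real.cos (p 1) + Real.cos (p 2)) / 2) 0 *
            Real.sqrt (2 / (1 - (Real.cos (p 1) + Real.cos (p 2)) / 2))) := by
  -- abbreviations
  set c0 := Real.cos (p 0)
  set c1 := Real.cos (p 1)
  set c2 := Real.cos (p 2)
  set H : ℝ → ℝ := fun y => max y 0 * Real.sqrt (2 / (1 - y)) with hH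
  have hκ : (0 : ℝ) < ∑ i, (![(1 : ℝ), 1, r]) i := by
    simp [Fin.sum_univ_three]; linarith
  have hκ' : ∑ i, (![(1 : ℝ), 1, r]) i = 2 + r := by simp [Fin.sum_univ_three]; ring
  have hC : anisoCosSum ![(1 : ℝ), 1, r] p = c0 + c1 + r * c2 := by
    simp [anisoCosSum, Fin.sum_univ_three, c0, c1, c2]
  rw [anisoKlsIntegrand_eq_klsH hκ, hκ', hC]
  -- the weights and the decomposition of the mean (before abbreviating)
  have h2r : 0 < 2 + r := by linarith
  have hsum : (2 - r) / (2 + r) + r / (2 + r) + r / (2 + r) = 1 := by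
    field_simp; ring
  have hy : (c0 + c1 + r * c2) / (2 + r) =
      (2 - r) / (2 + r) * ((c0 + c1) / 2) + r / (2 + r) * ((c0 + c2) / 2) +
        r / (2 + r) * ((c1 + c2) / 2) := by
    field_simp; ring
  set Y01 := (c0 + c1) / 2 with hY01_def
  set Y02 := (c0 + c2) / 2 with hY02_def
  set Y12 := (c1 + c2) / 2 with hY12_def
  set l12 := (2 - r) / (2 + r) with hl12_def
  set l := r / (2 + r) with hl_def
  have hl12 : 0 ≤ l12 := div_nonneg (by linarith) h2r.le
  have hl : 0 ≤ l := div_nonneg hr0 h2r.le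
  -- each pair average is < 1, and so is every positive part
  have hY01 : Y01 < 1 := by
    have := hp 0 1 (by decide); rw [hY01_def]; linarith
  have hY02 : Y02 < 1 := by
    have := hp 0 2 (by decide); rw [hY02_def]; linarith
  have hY12 : Y12 < 1 := by
    have := hp 1 2 (by decide); rw [hY12_def]; linarith
  have hP01 : max Y01 0 < 1 := max_lt hY01 one_pos
  have hP02 : max Y02 0 < 1 := max_lt hY02 one_pos
  have hP12 : max Y12 0 < 1 := max_lt hY12 one_pos
  -- step 1: subadditivity of the positive part and monotonicity of H
  set z := l12 * max Y01 0 + l * max Y02 0 + l * max Y12 0 with hz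
  have hz1 : z < 1 := by
    set m := max (max Y01 0) (max (max Y02 0) (max Y12 0)) with hm
    have hm1 : m < 1 := max_lt hP01 (max_lt hP02 hP12)
    have b1 : max Y01 0 ≤ m := le_max_left _ _
    have b2 : max Y02 0 ≤ m := (le_max_left _ _).trans (le_max_right _ _)
    have b3 : max Y12 0 ≤ m := (le_max_right _ _).trans (le_max_right _ _)
    calc z ≤ l12 * m + l * m + l * m := by rw [hz]; gcongr
      _ = m := by rw [← add_mul, ← add_mul, hsum, one_mul]
      _ < 1 := hm1
  have hyz : l12 * Y01 + l * Y02 + l * Y12 ≤ z := by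
    have a1 : l12 * Y01 ≤ l12 * max Y01 0 := mul_le_mul_of_nonneg_left (le_max_left _ _) hl12
    have a2 : l * Y02 ≤ l * max Y02 0 := mul_le_mul_of_nonneg_left (le_max_left _ _) hl
    have a3 : l * Y12 ≤ l * max Y12 0 := mul_le_mul_of_nonneg_left (le_max_left _ _) hl
    rw [hz]; linarith
  have hypos : max ((c0 + c1 + r * c2) / (2 + r)) 0 ≤ z := by
    rw [hy]
    exact max_le hyz (by rw [hz]; positivity)
  have hylt : (c0 + c1 + r * c2) / (2 + r) < 1 := by rw [hy]; exact hyz.trans_lt hz1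
  -- H(y) = H(y₊) and H is monotone below 1
  have hfix : ∀ Y : ℝ, H (max Y 0) = H Y := by
    intro Y
    simp only [hH]
    rcases le_or_gt Y 0 with h | h
    · simp [max_eq_right h]
    · simp [max_eq_left h.le]
  have step1 : H ((c0 + c1 + r * c2) / (2 + r)) ≤ H z := by
    rw [← hfix ((c0 + c1 + r * c2) / (2 + r))]
    exact monotoneOn_klsH (show max ((c0 + c1 + r * c2) / (2 + r)) 0 ∈ Iio (1 : ℝ) from
      max_lt hylt one_pos) (show z ∈ Iio (1 : ℝ) from hz1) hypos
  -- step 2: Jensen for the convex H on (-∞, 1) with the three weights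
  have step2 : H z ≤ l12 * H (max Y01 0) + l * H (max Y02 0) + l * H (max Y12 0) := by
    have hJ := convexOn_klsH.map_sum_le (t := (Finset.univ : Finset (Fin 3)))
      (w := ![l12, l, l]) (p := ![max Y01 0, max Y02 0, max Y12 0]) ?_ ?_ ?_
    · simpa [Fin.sum_univ_three, smul_eq_mul, hH, hz] using hJ
    · intro i _; fin_cases i <;> simp [hl12, hl]
    · simpa [Fin.sum_univ_three] using hsum
    · intro i _; fin_cases i <;> simp [hP01, hP02, hP12]
  rw [hfix, hfix, hfix] at step2
  simpa only [hH] using step1.trans step2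

end Pairs

end Literature.MathematicalPhysics.QuantumLattice
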